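import Summits.BirchSwinnertonDyer.Rank1Residual.GaloisImage.WildThreeAdicTower
import HarnessLib

/-!
# The `9`-torsion ABSCISSA relative to a `2`-torsion abscissa on the wild locus
# `1 ≤ v₃(j − 1728) = m ≤ 4`: `v(x₀(Q) − e)¹⁶² · v(3)^m = v(Δ)²⁷`
# (cell `b2b-bsdres`, team n1011, seat p02 gen 4 — row T-b11 ARM A 'm = 3 structure', file F3b;
# the abscissa twin of ARM A's ordinate witness `exists_nineTorsion_csOrdinate_valuation`, p261770)

HONEST FRAMING (cell `b2b-bsdres`, run/shared/lean/b2b/bsd-rank1-residual/, verbatim in every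
file): the goal of the cell is to DELETE the COMBINATION-SHAPED residual classes of the
Birch–Swinnerton-Dyer formula for ALL analytic-rank `≤ 1` elliptic curves over `ℚ` — "full BSD
formula for every rank `≤ 1` curve in class `C`" assembled STRICTLY from published theorems — so
that the rank-`≤ 1` remainder becomes exactly the CONSTRUCTION-SHAPED classes, which are TYPED
(missing-input `Prop`s), NOT attempted. This is not "finishing BSD". Team n1011 (N10 / N11):
research route; no claim beyond the stated classes; labels UNCHANGED; nothing is booked. Theorems
only (no definition, no named fact).

## What this file proves

* `exists_nineTorsion_abscissa_sub_twoTorsion_valuation` — for `E = W/ℚ` (any model) with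
  `1 ≤ v₃(j − 1728) = m ≤ 4` there are a geometric point `Q = (x₀, y₀)` with `9Q = O` and a
  `2`-torsion point `T = (e, y_e)` (`2T = O`) with `x₀ ≠ e` and
  **`v(x₀ − e)¹⁶² · v(3)^m = v(Δ)²⁷`**, i.e. `162·val(x₀ − e) = 27·v₃(Δ) − m`
  (`val(x₀ − e) = v₃(Δ)/6 − m/162`).

Proof = ARM A's transport read on the abscissa: in the normal shape `E'' = C • (W ⊗ ℚ̄)`
(`y² = x³ + A x² + x`, `exists_variableChange_normalShape`) the point `Q'' = (x'', y'')` of order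
`9` above a non-canonical `3`-torsion abscissa has `v(x'')¹⁶² v(3)^m = 1`
(`valuation_pow_162_eq_of_mul_rel_wild`); back on `W`, `x₀ = u²x'' + r` (`VariableChange.ofX_def`)
where `r = C.ofX 0` is the abscissa of the `2`-torsion point `C⁻¹ • (0, 0)` (`a₆'' = 0`,
`a₁'' = a₃'' = 0`), and `v(u)¹² = v(Δ_W)` since `v(Δ'') = 1`.  At `m = 3` the `3`-part of the
denominator of `val(x₀ − e)` is `27` (vs `9` for the ordinate): the source of the `27 ∣ #ρ̄₉(I₃)`
phenomenon on the `f₃ = 3`, `v₃(j) ≥ 6` rows once `e` is replaced by a nearby element of `ℚ(E[3])`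
(file F3c).  Nothing booked; no label change.

References: [SilvermanAEC2009] III.1 (Table 3.1), Ex. 3.7; [SerreLocalFields1979] Ch. I §7;
[Katz1973] §3.7 (canonical subgroup).
-/

noncomputable section

-- as in `WildThreeAdicTower`: numerals `x ^ 162` on the value group need a deeper recursion limit
set_option maxRecDepth 10000

open scoped Classical

open Polynomial WeierstrassCurve

namespace Summit.BirchSwinnertonDyer.Rank1Residual.GaloisImage

open Literature.NumberTheory.EllipticCurves Literature.NumberTheory.GaloisRepresentations
  Rat.HeightOneSpectrum

variable (W : WeierstrassCurve ℚ) [W.IsElliptic]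

/-- **The abscissa valuation witness.**  For `E/ℚ` with `1 ≤ v₃(j − 1728) = m ≤ 4` there are a
geometric point `Q = (x₀, y₀)` with `9Q = O` and a `2`-torsion point `T = (e, y_e)` of `E ⊗ ℚ̄`
with `x₀ ≠ e` and `v(x₀ − e)¹⁶² · v(3)^m = v(Δ)²⁷` (`Δ` read in `ℚ̄`; equivalently
`162·val(x₀ − e) = 27·v₃(Δ) − m`). [folklore]
[cite: SilvermanAEC2009, III.1 Table 3.1] -/
theorem exists_nineTorsion_abscissa_sub_twoTorsion_valuation {m : ℕ} (hm1 : 1 ≤ m) (hm4 : m ≤ 4)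
    (hj : padicValRat 3 (W.j - 1728) = m) :
    ∃ (Q : W.geomPoints) (x y e ye : AlgebraicClosure ℚ)
      (h : (W.map (algebraMap ℚ (AlgebraicClosure ℚ))).toAffine.Nonsingular x y)
      (he : (W.map (algebraMap ℚ (AlgebraicClosure ℚ))).toAffine.Nonsingular e ye),
      Q = .some x y h ∧ (9 : ℤ) • Q = 0 ∧
      (2 : ℤ) • (Affine.Point.some e ye he :
        (W.map (algebraMap ℚ (AlgebraicClosure ℚ))).toAffine.Point) = 0 ∧
      x - e ≠ 0 ∧
      (placeOver 3).valuation (x - e) ^ 162 * (placeOver 3).valuation (3 : AlgebraicClosure ℚ) ^ m =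
        (placeOver 3).valuation (algebraMap ℚ (AlgebraicClosure ℚ) W.Δ) ^ 27 := by
  set v := (placeOver 3).valuation with hv
  set t := v (3 : AlgebraicClosure ℚ) with ht
  have ht0 : t ≠ 0 := valuation_three_ne_zero
  -- §2 of ARM A: normal shape
  obtain ⟨C, h1, h3, h4, h6, hs, htC⟩ := exists_variableChange_normalShape (W.map (algebraMap ℚ (AlgebraicClosure ℚ)))
  set E'' := C • W.map (algebraMap ℚ (AlgebraicClosure ℚ)) with hE''
  -- the shape exponent from `j`
  have hq0 : W.j - 1728 ≠ 0 := by
    intro h0; rw [h0, padicValRat.zero] at hj; exact_mod_cast (show (m : ℤ) ≠ 0 by omega) hj.symm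
  have hjK : v (E''.j - 1728) = t ^ m := by
    have : E''.j - 1728 = algebraMap ℚ (AlgebraicClosure ℚ) (W.j - 1728) := by
      rw [show E''.j = (W.map (algebraMap ℚ (AlgebraicClosure ℚ))).j from variableChange_j _ _, map_j, map_sub,
        map_ofNat]
    rw [this]
    exact valuation_ratCast_eq_pow_of_padicValRat hq0 hj
  obtain ⟨hα1, -, hΔ1, hα⟩ :=
    valuation_a₂_of_shape_of_j (W := E'') h1 h3 h4 h6 hm1 (hm4.trans (by norm_num)) hjK
  -- a non-canonical `3`-torsion abscissa and a point above it
  obtain ⟨ξ, hξroot, hξ⟩ := exists_isRoot_Ψ₃_wild (W := E'') h1 h3 h4 h6 hm1 hm4 hα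
  obtain ⟨η, hη⟩ := IsAlgClosed.exists_pow_nat_eq (ξ ^ 3 + E''.a₂ * ξ ^ 2 + ξ) (by norm_num : 0 < 2)
  have hPeq : E''.toAffine.Equation ξ η := by
    rw [Affine.equation_iff, h1, h3, h4, h6, hη]; ring
  have hPns : E''.toAffine.Nonsingular ξ η := (Affine.equation_iff_nonsingular ..).mp hPeq
  have hP3 : (3 : ℤ) • (Affine.Point.some ξ η hPns : E''.toAffine.Point) = 0 := by
    refine (zsmul_some_eq_zero_iff_eval_ΨSq E'' hPns 3).mpr ?_
    rw [ΨSq_three, eval_pow, hξroot.eq_zero, zero_pow two_ne_zero]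
  -- pull back to `W ⊗ ℚ̄`, divide by `3`, push forward
  set φ := VariableChange.pointEquiv (W.map (algebraMap ℚ (AlgebraicClosure ℚ))) C with hφ
  set P₀ : (W.map (algebraMap ℚ (AlgebraicClosure ℚ))).toAffine.Point := φ.symm (Affine.Point.some ξ η hPns) with hP₀
  have hP₀3 : (3 : ℤ) • P₀ = 0 := by rw [hP₀, ← map_zsmul, hP3, map_zero]
  obtain ⟨Q₀, hQ₀3⟩ : ∃ Q₀ : (W.map (algebraMap ℚ (AlgebraicClosure ℚ))).toAffine.Point, (3 : ℤ) • Q₀ = P₀ :=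
    W.zsmul_geomPoints_surjective_holds (n := 3) (by norm_num) P₀
  have hQ₀9 : (9 : ℤ) • Q₀ = 0 := by
    rw [show (9 : ℤ) = 3 * 3 by norm_num, mul_smul, hQ₀3, hP₀3]
  have hQ''3 : (3 : ℤ) • φ Q₀ = Affine.Point.some ξ η hPns := by
    rw [← map_zsmul, hQ₀3, hP₀, AddEquiv.apply_symm_apply]
  have hQ''0 : φ Q₀ ≠ 0 := by
    intro h0; rw [h0, smul_zero] at hQ''3; exact Affine.Point.some_ne_zero _ hQ''3.symm
  rcases hQ'' : φ Q₀ with _ | ⟨x'', y'', h''⟩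
  · exact absurd hQ'' hQ''0
  rw [hQ''] at hQ''3
  -- the abscissa of `φ Q₀ = (x'', y'')`: F1 §3 of ARM A
  have hrel : ξ * (E''.Ψ₃.eval x'') ^ 2 = (E''.Φ 3).eval x'' := by
    have := mul_eval_ΨSq_of_zsmul_eq E'' h'' 3 hPns hQ''3
    rwa [ΨSq_three, eval_pow] at this
  have hx'' := valuation_pow_162_eq_of_mul_rel_wild (W := E'') h1 h3 h4 h6 hm1 hm4 hα hrel hξ
  -- back on `W`: `Q₀ = (u²x'' + r, …)`
  have hQ₀eq : Q₀ = φ.symm (Affine.Point.some x'' y'' h'') := by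
    rw [← hQ'', AddEquiv.symm_apply_apply]
  rw [hφ, VariableChange.pointEquiv_symm_apply, VariableChange.pointInv_some] at hQ₀eq
  -- the `2`-torsion point `(0, 0)` of the shape and its image `(r, …)` on `W`
  have h0eq : E''.toAffine.Equation 0 0 := by
    rw [Affine.equation_iff, h1, h3, h4, h6]; ring
  have h0ns : E''.toAffine.Nonsingular 0 0 := (Affine.equation_iff_nonsingular ..).mp h0eq
  have h02 : (2 : ℤ) • (Affine.Point.some 0 0 h0ns : E''.toAffine.Point) = 0 := by
    refine (zsmul_some_eq_zero_iff_eval_ΨSq E'' h0ns 2).mpr ?_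
    rw [ΨSq_two]
    simp only [WeierstrassCurve.Ψ₂Sq, WeierstrassCurve.b₂, WeierstrassCurve.b₄, WeierstrassCurve.b₆,
      eval_add, eval_mul, eval_C, eval_pow, eval_X, h1, h3, h6]
    ring
  set T₀ : (W.map (algebraMap ℚ (AlgebraicClosure ℚ))).toAffine.Point := φ.symm (Affine.Point.some 0 0 h0ns) with hT₀
  have hT₀2 : (2 : ℤ) • T₀ = 0 := by rw [hT₀, ← map_zsmul, h02, map_zero]
  have hT₀eq : T₀ = φ.symm (Affine.Point.some 0 0 h0ns) := rfl
  rw [hφ, VariableChange.pointEquiv_symm_apply, VariableChange.pointInv_some] at hT₀eq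
  refine ⟨Q₀, C.ofX x'', C.ofY x'' y'', C.ofX 0, C.ofY 0 0, _,
    (VariableChange.nonsingular_ofXY_iff (W.map (algebraMap ℚ (AlgebraicClosure ℚ))) C 0 0).mpr h0ns,
    hQ₀eq, hQ₀9, ?_, ?_, ?_⟩
  · rw [← hT₀eq]; exact hT₀2
  all_goals
    have hxe : C.ofX x'' - C.ofX 0 = (C.u : AlgebraicClosure ℚ) ^ 2 * x'' := by
      rw [VariableChange.ofX_def, VariableChange.ofX_def]; ring
  · -- `x₀ − e ≠ 0`
    rw [hxe]
    have hvx0 : v x'' ≠ 0 := by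
      intro h0; rw [h0, zero_pow (by norm_num), zero_mul] at hx''; exact zero_ne_one hx''
    exact mul_ne_zero (pow_ne_zero _ C.u.ne_zero) ((Valuation.ne_zero_iff _).mp hvx0)
  · -- the valuation identity
    rw [hxe, map_mul, map_pow]
    have huΔ : v (C.u : AlgebraicClosure ℚ) ^ 12 = v (algebraMap ℚ (AlgebraicClosure ℚ) W.Δ) := by
      have e1 : E''.Δ = (C.u⁻¹ : (AlgebraicClosure ℚ)ˣ) ^ 12 * algebraMap ℚ (AlgebraicClosure ℚ) W.Δ := by
        rw [hE'', variableChange_Δ, map_Δ]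
      have := congrArg v e1
      rw [hΔ1, map_mul, map_pow, Units.val_inv_eq_inv_val, map_inv₀] at this
      have hvu0 : v (C.u : AlgebraicClosure ℚ) ≠ 0 := (Valuation.ne_zero_iff _).mpr C.u.ne_zero
      rw [inv_pow, eq_comm, inv_mul_eq_one₀ (pow_ne_zero _ hvu0)] at this
      exact this
    -- `(v u² · v x'')^{162} t^m = ((v u)^{12})^{27} · (v x''^{162} t^m)`
    calc (v (C.u : AlgebraicClosure ℚ) ^ 2 * v x'') ^ 162 * t ^ m
        = (v (C.u : AlgebraicClosure ℚ) ^ 12) ^ 27 * (v x'' ^ 162 * t ^ m) := by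
          rw [mul_pow, ← pow_mul, ← pow_mul, show 2 * 162 = 12 * 27 from rfl]
          simp only [mul_assoc, mul_comm, mul_left_comm]
      _ = v (algebraMap ℚ (AlgebraicClosure ℚ) W.Δ) ^ 27 := by rw [huΔ, hx'', mul_one]

end Summit.BirchSwinnertonDyer.Rank1Residual.GaloisImage

end
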